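import Summits.ValiantsHypothesis.ValiantsHypothesis.Theorems.KPlusLogSqLawTropicalBSeparatedLevelStep
import Summits.ValiantsHypothesis.ValiantsHypothesis.Theorems.KPlusLogSqLawTropicalBSeparatedThreeAll

/-!
# Route «KPlusLogSqLaw», crux `TropicalB` (stmt-ValiantsHypothesis-19771) — THE LEXICOGRAPHIC TOWER: a pure lexicographic design with
# a dense bottom class (half-integer normalisation) has at most `K·m·5^K` terms in any dominant chain of its window — LINEAR IN `m`

HONEST FRAMING.  Helper toward the registered stubs `stub_tropThin` / `stub_tropFat` of `Cruxes/TropicalB/Lines/birth.lean`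
(crux `Summit.ValiantsHypothesis.ValiantsHypothesis.Theses.KPlusLogSqLaw.TropicalB`, item stmt-ValiantsHypothesis-19771, route
KPlusLogSqLaw; cell `pub-symmetroid`, seat val-sym-trop-p1 g8, 2026-08-27; `--supports … --as helper`).  A SECTOR theorem; nothing here
bounds `TropicalB` for general designs or bears on `WeakLifting`, DoorA26 / DoorA34, `MatrixDescartes` (stmt-ValiantsHypothesis-18050)
or VP ≠ VNP.

THE THEOREM (`chain_le_tower`; memo SEPARATED-LEVELS-g8.md §2, all `K`).  Design of format `(m, K)` with classes in increasing exponent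
order (`StrictMono d`), bottom class `z` (`d z = 0`) PRESENT ON EVERY ENTRY with `|v| ≤ A`, every other class `j` with valuations
`v = d j · u`, ODD digits `|u| ≤ A` (the half-integer normalisation: no level ever ties at an even slope), generic digits per class,
super-separated exponents (`8m²(A+1)·d j ≤ d j'` for `d j < d j'`, `8m²(A+1) ≤ d j` for `j ≠ z`).  Then every chain of distinct
consecutive terms dominant at strictly increasing EVEN integer slopes of the window `|θ| ≤ (2m+1)A + 1` has

  `n ≤ K · m · 5^K`   — linear in `m`, i.e. inside `TropicalB`'s budget with room to spare (`≤ 2^{3K + log₂ m}`), at EVERY `K`,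

whereas slope counting allows `C(m+K−1, m) − 1 ≈ m^{K−1}`.  (Even slopes for the design `(d, v)` are all integer slopes for the design
`(2d, v)`: `tropWeight (2d) v θ = tropWeight d v (2θ)`.)  PROOF = the T/A recursion of the memo with the potential
`Σ_{l ≠ z} (c_l + 2·T_l)` (strictly increasing along the chain by `level_step`), `T_{l} ≤ 5·T_{l+1} + 2m`, `T_top = 0`.
-/

set_option linter.dupNamespace false
set_option autoImplicit false

namespace Summit.ValiantsHypothesis.ValiantsHypothesis.Theorems.KPlusLogSqLaw

namespace SeparatedLex

open Summit.ValiantsHypothesis.ValiantsHypothesis.Theorems.MatrixDescartes.Negative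
open Finset
open scoped BigOperators
open Literature.Computability.MetaComplexity.PBij
open MatchingExchange

variable {m K : ℕ}

/-- rows covered by the class-`l` cells of a term. [folklore] -/
theorem dom_cells (p : Equiv.Perm (Fin m) × (Fin m → Fin K)) (l : Fin K) :
    dom ((Finset.univ.filter fun b : Fin m => p.2 b = l).image fun b => (p.1 b, b)) =
      (Finset.univ.filter fun b : Fin m => p.2 b = l).image p.1 := by
  ext a
  rw [mem_dom, Finset.mem_image]
  constructor
  · rintro ⟨b, hb⟩; rw [mem_cells] at hb; exact ⟨b, Finset.mem_filter.2 ⟨Finset.mem_univ _, hb.2⟩, hb.1.symm⟩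
  · rintro ⟨b, hb, hba⟩; exact ⟨b, mem_cells.2 ⟨hba.symm, (Finset.mem_filter.1 hb).2⟩⟩

/-- columns covered by the class-`l` cells of a term. [folklore] -/
theorem rng_cells (p : Equiv.Perm (Fin m) × (Fin m → Fin K)) (l : Fin K) :
    rng ((Finset.univ.filter fun b : Fin m => p.2 b = l).image fun b => (p.1 b, b)) =
      Finset.univ.filter fun b : Fin m => p.2 b = l := by
  ext b
  rw [mem_rng, Finset.mem_filter]
  constructor
  · rintro ⟨a, ha⟩; rw [mem_cells] at ha; exact ⟨Finset.mem_univ _, ha.2⟩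
  · rintro ⟨-, hb⟩; exact ⟨p.1 b, mem_cells.2 ⟨rfl, hb⟩⟩

/-- the box one class down: the rows free below `l+1` minus the rows of the class-`(l+1)` cells are the rows free below `l`. -/
theorem rows_succ (p : Equiv.Perm (Fin m) × (Fin m → Fin K)) (l l' : Fin K) (hl : (l' : ℕ) = l + 1) :
    Finset.univ \ (Finset.univ.filter fun b => l < p.2 b).image p.1 =
      (Finset.univ \ (Finset.univ.filter fun b => l' < p.2 b).image p.1) \
        dom ((Finset.univ.filter fun b : Fin m => p.2 b = l').image fun b => (p.1 b, b)) := by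
  rw [dom_cells]
  ext a
  simp only [Finset.mem_sdiff, Finset.mem_univ, true_and, Finset.mem_image, Finset.mem_filter, not_exists, not_and]
  constructor
  · intro h
    refine ⟨fun b hb => h b (lt_trans (by rw [Fin.lt_def]; omega) hb), fun b hb => h b (by rw [Fin.lt_def, hb]; omega)⟩
  · rintro ⟨h1, h2⟩ b hb
    rcases lt_or_eq_of_le (show (l' : ℕ) ≤ p.2 b by rw [hl]; exact hb) with h | h
    · exact h1 b (Fin.lt_def.2 h)
    · exact h2 b (Fin.ext h).symm

/-- the same for columns. -/
theorem cols_succ (p : Equiv.Perm (Fin m) × (Fin m → Fin K)) (l l' : Fin K) (hl : (l' : ℕ) = l + 1) :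
    Finset.univ \ (Finset.univ.filter fun b => l < p.2 b) =
      (Finset.univ \ (Finset.univ.filter fun b => l' < p.2 b)) \
        rng ((Finset.univ.filter fun b : Fin m => p.2 b = l').image fun b => (p.1 b, b)) := by
  rw [rng_cells]
  ext b
  simp only [Finset.mem_sdiff, Finset.mem_univ, true_and, Finset.mem_filter, not_lt]
  constructor
  · intro h
    refine ⟨le_trans h (Fin.le_def.2 (by omega)), fun hb => ?_⟩
    rw [hb, Fin.le_def] at h; omega
  · rintro ⟨h1, h2⟩
    rcases lt_or_eq_of_le h1 with h | h
    · rw [Fin.le_def]; rw [Fin.lt_def] at h; omega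
    · exact absurd h h2

/-- **THE TOWER THEOREM.**  See the module docstring. -/
theorem chain_le_tower (d : Fin K → ℕ) (v ε : Fin m → Fin m → Fin K → ℤ) (u : Fin m → Fin m → Fin K → ℤ)
    (A : ℕ) (z : Fin K) (hdz : d z = 0) (hmono : StrictMono d)
    (hu : ∀ a b j, j ≠ z → v a b j = (d j : ℤ) * u a b j) (huA : ∀ a b j, |u a b j| ≤ A) (hvz : ∀ a b, |v a b z| ≤ A)
    (hdense : ∀ a b, ε a b z ≠ 0)
    (hsep : ∀ j j', d j < d j' → 8 * m ^ 2 * (A + 1) * d j ≤ d j') (hsep0 : ∀ j, j ≠ z → 8 * m ^ 2 * (A + 1) ≤ d j)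
    (hodd : ∀ a b j, j ≠ z → ε a b j ≠ 0 → Odd (u a b j))
    (hgen : ∀ j, j ≠ z → ∀ X Y : Finset (Fin m × Fin m), IsPMatching X → IsPMatching Y → (∀ e ∈ X, ε e.1 e.2 j ≠ 0) →
      (∀ e ∈ Y, ε e.1 e.2 j ≠ 0) → X.card = Y.card → ∑ e ∈ X, u e.1 e.2 j = ∑ e ∈ Y, u e.1 e.2 j → X = Y)
    {n : ℕ} (θ : Fin (n + 1) → ℤ) (p : Fin (n + 1) → Equiv.Perm (Fin m) × (Fin m → Fin K))
    (hθ : StrictMono θ) (heven : ∀ k, Even (θ k)) (hwin : ∀ k, |θ k| ≤ (2 * m + 1) * A + 1)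
    (hdom : ∀ k, IsDominant d v ε (θ k) (p k)) (hne : ∀ k : Fin n, p k.castSucc ≠ p k.succ) :
    n ≤ K * m * 5 ^ K := by
  classical
  -- `z` is the least class
  have hz0 : (z : ℕ) = 0 := by
    by_contra h
    have : d ⟨0, by omega⟩ < d z := hmono (Fin.lt_def.2 (by simp; omega))
    rw [hdz] at this; exact Nat.not_lt_zero _ this
  have hKpos : 0 < K := Fin.pos z
  -- the objects of the tower
  let Ua : Fin K → Fin (n + 1) → Finset (Fin m) := fun l k => Finset.univ \ (Finset.univ.filter fun b => l < (p k).2 b).image (p k).1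
  let Ub : Fin K → Fin (n + 1) → Finset (Fin m) := fun l k => Finset.univ \ (Finset.univ.filter fun b => l < (p k).2 b)
  let S : Fin K → Fin (n + 1) → Finset (Fin m × Fin m) := fun l k =>
    (Finset.univ.filter fun b : Fin m => (p k).2 b = l).image fun b => ((p k).1 b, b)
  let sd : Fin K → Fin n → ℕ := fun l k => (Ua l k.castSucc \ Ua l k.succ).card + (Ua l k.succ \ Ua l k.castSucc).card +
    (Ub l k.castSucc \ Ub l k.succ).card + (Ub l k.succ \ Ub l k.castSucc).card
  -- THE STEP at every level l ≠ z
  have hstep : ∀ (l : Fin K), l ≠ z → ∀ k : Fin n,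
      (S l k.castSucc).card ≤ (S l k.succ).card + (Ua l k.castSucc \ Ua l k.succ).card + (Ub l k.castSucc \ Ub l k.succ).card ∧
      ((Ua l k.castSucc \ dom (S l k.castSucc)) \ (Ua l k.succ \ dom (S l k.succ))).card +
        ((Ua l k.succ \ dom (S l k.succ)) \ (Ua l k.castSucc \ dom (S l k.castSucc))).card +
        ((Ub l k.castSucc \ rng (S l k.castSucc)) \ (Ub l k.succ \ rng (S l k.succ))).card +
        ((Ub l k.succ \ rng (S l k.succ)) \ (Ub l k.castSucc \ rng (S l k.castSucc))).card + 2 * (S l k.castSucc).card ≤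
        5 * sd l k + 2 * (S l k.succ).card ∧
      (S l k.castSucc ≠ S l k.succ → (S l k.castSucc).card + 1 ≤ (S l k.succ).card + 2 * sd l k) :=
    fun l hl k => level_step d v ε u A z l hl hdz hmono hu huA hvz hdense hsep hsep0 (fun a b he => hodd a b l hl he) (hgen l hl)
      (hθ Fin.castSucc_lt_succ) (heven k.succ) (hwin k.castSucc) (hwin k.succ) (hdom k.castSucc) (hdom k.succ)
  -- every step changes some level l ≠ z
  have hchg : ∀ k : Fin n, ∃ l : Fin K, l ≠ z ∧ S l k.castSucc ≠ S l k.succ := by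
    intro k
    by_contra hall
    have hall' : ∀ l : Fin K, l ≠ z → S l k.castSucc = S l k.succ := fun l hl => by
      by_contra h; exact hall ⟨l, hl, h⟩
    refine not_dominant_of_cls_eq d v ε (hdom k.castSucc) (hdom k.succ) (hne k) ?_
    funext b
    have key : ∀ (q q' : Equiv.Perm (Fin m) × (Fin m → Fin K)) (j : Fin K), j ≠ z →
        ((Finset.univ.filter fun b : Fin m => q.2 b = j).image fun b => (q.1 b, b)) =
          ((Finset.univ.filter fun b : Fin m => q'.2 b = j).image fun b => (q'.1 b, b)) → q.2 b = j → q'.2 b = j := by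
      intro q q' j _ hS hb
      have : b ∈ rng ((Finset.univ.filter fun b : Fin m => q.2 b = j).image fun b => (q.1 b, b)) := by
        rw [rng_cells, Finset.mem_filter]; exact ⟨Finset.mem_univ _, hb⟩
      rw [hS, rng_cells, Finset.mem_filter] at this
      exact this.2
    by_cases h0 : (p k.castSucc).2 b = z
    · by_cases h1 : (p k.succ).2 b = z
      · rw [h0, h1]
      · have := key (p k.succ) (p k.castSucc) _ h1 (hall' _ h1).symm rfl
        exact absurd (this.symm.trans h0) h1
    · exact (key (p k.castSucc) (p k.succ) _ h0 (hall' _ h0) rfl).symm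
  -- prefix sums over ℕ indices
  let cN : Fin K → ℕ → ℕ := fun l i => if h : i < n + 1 then (S l ⟨i, h⟩).card else 0
  let sN : Fin K → ℕ → ℕ := fun l i => if h : i < n then sd l ⟨i, h⟩ else 0
  let T : Fin K → ℕ → ℕ := fun l i => ∑ j ∈ Finset.range i, sN l j
  have hT_succ : ∀ l i, T l (i + 1) = T l i + sN l i := fun l i => Finset.sum_range_succ _ _
  have hcN_le : ∀ l i, cN l i ≤ m := by
    intro l i; simp only [cN]; split_ifs with h
    · exact card_le_of_isPMatching (isPMatching_cells _ _)
    · exact Nat.zero_le _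
  -- the potential Σ_{l ≠ z} (c_l + 2 T_l) increases at every step
  let L : Finset (Fin K) := Finset.univ.erase z
  have hpot : ∀ i : ℕ, i ≤ n → (∑ l ∈ L, cN l 0) + i ≤ ∑ l ∈ L, (cN l i + 2 * T l i) := by
    intro i
    induction i with
    | zero => intro _; simp [T]
    | succ i ih =>
      intro hi
      have h1 := ih (by omega)
      set k : Fin n := ⟨i, by omega⟩ with hk
      have ek0 : k.castSucc = ⟨i, by omega⟩ := rfl
      have ek1 : k.succ = ⟨i + 1, by omega⟩ := rfl
      -- per level: no decrease; at the changed level: increase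
      have hmono_l : ∀ l ∈ L, cN l i + 2 * T l i ≤ cN l (i + 1) + 2 * T l (i + 1) := by
        intro l hl
        have hlz : l ≠ z := Finset.ne_of_mem_erase hl
        obtain ⟨a1, -, -⟩ := hstep l hlz k
        rw [ek0, ek1] at a1
        have e0 : cN l i = (S l ⟨i, by omega⟩).card := by simp only [cN, dif_pos (show i < n + 1 by omega)]
        have e1 : cN l (i + 1) = (S l ⟨i + 1, by omega⟩).card := by simp only [cN, dif_pos (show i + 1 < n + 1 by omega)]
        have e2 : sN l i = sd l k := by simp only [sN, dif_pos (show i < n by omega), hk]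
        rw [hT_succ, e0, e1, e2]
        have : (Ua l k.castSucc \ Ua l k.succ).card + (Ub l k.castSucc \ Ub l k.succ).card ≤ sd l k := by
          simp only [sd]; omega
        rw [ek0, ek1] at this
        omega
      obtain ⟨l₀, hl₀z, hl₀⟩ := hchg k
      have hl₀L : l₀ ∈ L := Finset.mem_erase.2 ⟨hl₀z, Finset.mem_univ _⟩
      have hstrict : cN l₀ i + 2 * T l₀ i + 1 ≤ cN l₀ (i + 1) + 2 * T l₀ (i + 1) := by
        obtain ⟨-, -, a3⟩ := hstep l₀ hl₀z k
        have a3' := a3 hl₀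
        rw [ek0, ek1] at a3'
        have e0 : cN l₀ i = (S l₀ ⟨i, by omega⟩).card := by simp only [cN, dif_pos (show i < n + 1 by omega)]
        have e1 : cN l₀ (i + 1) = (S l₀ ⟨i + 1, by omega⟩).card := by simp only [cN, dif_pos (show i + 1 < n + 1 by omega)]
        have e2 : sN l₀ i = sd l₀ k := by simp only [sN, dif_pos (show i < n by omega), hk]
        rw [hT_succ, e0, e1, e2]
        omega
      have s1 := Finset.sum_erase_add L (fun l => cN l i + 2 * T l i) hl₀L
      have s2 := Finset.sum_erase_add L (fun l => cN l (i + 1) + 2 * T l (i + 1)) hl₀L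
      have hrest : ∑ l ∈ L.erase l₀, (cN l i + 2 * T l i) ≤ ∑ l ∈ L.erase l₀, (cN l (i + 1) + 2 * T l (i + 1)) :=
        Finset.sum_le_sum fun l hl => hmono_l l (Finset.mem_of_mem_erase hl)
      omega
  -- the T recursion down the levels: T_l ≤ 5 T_{l+1} + 2m
  have hTrec : ∀ (l l' : Fin K), (l' : ℕ) = l + 1 → T l n ≤ 5 * T l' n + 2 * m := by
    intro l l' hl
    have hl'z : l' ≠ z := fun h => by rw [h, hz0] at hl; omega
    have inv : ∀ i : ℕ, i ≤ n → T l i + 2 * cN l' 0 ≤ 5 * T l' i + 2 * cN l' i := by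
      intro i
      induction i with
      | zero => intro _; simp [T]
      | succ i ih =>
        intro hi
        have h1 := ih (by omega)
        set k : Fin n := ⟨i, by omega⟩ with hk
        obtain ⟨-, a2, -⟩ := hstep l' hl'z k
        -- the free sets of level l' are the box of level l
        have r0 : Ua l k.castSucc = Ua l' k.castSucc \ dom (S l' k.castSucc) := rows_succ (p k.castSucc) l l' hl
        have r1 : Ua l k.succ = Ua l' k.succ \ dom (S l' k.succ) := rows_succ (p k.succ) l l' hl
        have c0 : Ub l k.castSucc = Ub l' k.castSucc \ rng (S l' k.castSucc) := cols_succ (p k.castSucc) l l' hl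
        have c1 : Ub l k.succ = Ub l' k.succ \ rng (S l' k.succ) := cols_succ (p k.succ) l l' hl
        have hsd : sd l k = ((Ua l' k.castSucc \ dom (S l' k.castSucc)) \ (Ua l' k.succ \ dom (S l' k.succ))).card +
            ((Ua l' k.succ \ dom (S l' k.succ)) \ (Ua l' k.castSucc \ dom (S l' k.castSucc))).card +
            ((Ub l' k.castSucc \ rng (S l' k.castSucc)) \ (Ub l' k.succ \ rng (S l' k.succ))).card +
            ((Ub l' k.succ \ rng (S l' k.succ)) \ (Ub l' k.castSucc \ rng (S l' k.castSucc))).card := by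
          simp only [sd]; rw [r0, r1, c0, c1]
        have e0 : cN l' i = (S l' k.castSucc).card := by simp only [cN, dif_pos (show i < n + 1 by omega)]; rfl
        have e1 : cN l' (i + 1) = (S l' k.succ).card := by simp only [cN, dif_pos (show i + 1 < n + 1 by omega)]; rfl
        have e2 : sN l i = sd l k := by simp only [sN, dif_pos (show i < n by omega), hk]
        have e3 : sN l' i = sd l' k := by simp only [sN, dif_pos (show i < n by omega), hk]
        rw [hT_succ, hT_succ, e1, e2, e3, hsd]
        rw [e0] at h1
        omega
    have := inv n le_rfl
    have := hcN_le l' n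
    omega
  -- the top level never flips
  have hTtop : T ⟨K - 1, by omega⟩ n = 0 := by
    apply Finset.sum_eq_zero
    intro j hj
    simp only [sN]
    split_ifs with h
    · have hempty : ∀ k : Fin (n + 1), (Finset.univ.filter fun b : Fin m => (⟨K - 1, by omega⟩ : Fin K) < (p k).2 b) = ∅ := by
        intro k; rw [Finset.filter_eq_empty_iff]; intro b _ hb
        rw [Fin.lt_def] at hb; have := ((p k).2 b).2; simp at hb; omega
      simp [sd, Ua, Ub, hempty]
    · rfl
  -- geometric bound: 2 T_l + m ≤ m · 5^(K-1-l)
  have hgeo : ∀ j : ℕ, (hj : j ≤ K - 1) → 2 * T ⟨K - 1 - j, by omega⟩ n + m ≤ m * 5 ^ j := by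
    intro j
    induction j with
    | zero =>
      intro _
      have e : (⟨K - 1 - 0, by omega⟩ : Fin K) = ⟨K - 1, by omega⟩ := Fin.ext (by simp)
      rw [e, hTtop]; simp
    | succ j ih =>
      intro hj
      have h1 := ih (by omega)
      have h2 := hTrec ⟨K - 1 - (j + 1), by omega⟩ ⟨K - 1 - j, by omega⟩ (by simp; omega)
      rw [pow_succ]
      nlinarith
  -- assemble
  have hfin := hpot n le_rfl
  have hbound : ∀ l ∈ L, cN l n + 2 * T l n ≤ m * 5 ^ K := by
    intro l hl
    have hlK : (l : ℕ) ≤ K - 1 := by have := l.2; omega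
    have h1 := hgeo (K - 1 - l) (by omega)
    have e : (⟨K - 1 - (K - 1 - (l : ℕ)), by omega⟩ : Fin K) = l := Fin.ext (by simp; omega)
    rw [e] at h1
    have h2 := hcN_le l n
    have h3 : m * 5 ^ (K - 1 - (l : ℕ)) ≤ m * 5 ^ K := Nat.mul_le_mul_left _ (Nat.pow_le_pow_right (by norm_num) (by omega))
    omega
  have hsum : ∑ l ∈ L, (cN l n + 2 * T l n) ≤ ∑ l ∈ L, m * 5 ^ K := Finset.sum_le_sum hbound
  rw [Finset.sum_const, smul_eq_mul] at hsum
  have hL : L.card ≤ K := (Finset.card_le_univ _).trans (by simp)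
  have : L.card * (m * 5 ^ K) ≤ K * (m * 5 ^ K) := Nat.mul_le_mul_right _ hL
  have h0 : 0 ≤ ∑ l ∈ L, cN l 0 := Nat.zero_le _
  calc n ≤ ∑ l ∈ L, (cN l n + 2 * T l n) := by omega
    _ ≤ K * m * 5 ^ K := by rw [Nat.mul_assoc]; omega

end SeparatedLex

end Summit.ValiantsHypothesis.ValiantsHypothesis.Theorems.KPlusLogSqLaw
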